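import Summits.ResolutionOfSingularities.ResolutionOfSingularities.Theorems.FrobeniusLadderFRationalResolutionEquivariantStep
import Summits.ResolutionOfSingularities.ResolutionOfSingularities.Theorems.FrobeniusLadderFRationalResolutionSimplicialConePrimSimplicial
import HarnessLib

/-!
# Crux `FrobeniusLadder.FRationalResolution` (stmt-ResolutionOfSingularities-15317), line `redirect`,
# stub `stub_diagonalizableQuotientResolution` — the EQUIVARIANT BOUNDARY-SPARING LADDER THEOREM (lane W‴, statement L2′)

Assembly of `…OrbitSeparation` (✓ p831037) and `…EquivariantStep` (✓ p831102) with the tree's synchronised loop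
`Fan.exists_regular_starIter_of_invariant` ([KempfEtAl1973] Ch. I §2 Thm. 11, Ch. II §2; [Fulton1993Toric] §2.6).
**Theorem (`exists_equivariant_regular_starIter`).** Let `σ = hull S₀ ⊆ ℚ^κ` be a simplicial cone on `≥ 2` primitive
linearly independent lattice vectors all of whose PROPER subfamilies are regular (an isolated simplicial singularity), and
`G` a finite set of lattice automorphisms of `ℚ^κ` containing `1`, closed under inverses and composition, each permuting
`S₀`. Then finitely many lattice star subdivisions — round 0 through the primitive vector `c` of the corner ray
`ℚ_{>0} Σ_{s ∈ S₀} s`, then `G`-ORBITS of parallelotope points of cones of maximal count — refine the face fan of `σ` to a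
fan which is regular and primitively simplicial, `G`-STABLE, keeps every proper face of `σ` as a cone (boundary-sparing),
and all of whose ray generators outside `S₀` satisfy any prescribed property `P` holding for `c` and closed under taking
parallelotope lattice points of cones generated by vectors in `S₀ ∪ P` (in lane W‴: substitution-safety,
`…SafeRayCentreStable.safe_of_parallelotope_decomposition`, ✓ p830566).

* `corner_notMem_of_isFaceOf_of_ne`, `smul_sum_notMem`, `sum_ne_zero` — the corner ray is interior, not a generator;
* `round_zero` — after the star through `c` the invariant package of `…EquivariantStep` holds;
* **`exists_equivariant_regular_starIter`** — the ladder theorem.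

Honest label: fan combinatorics for the DESIGN W‴ (this is the weight-free statement L2′ of memo MEMO-15317-leafhand4-g5
§5.7, now proved; its consumers — the cover comparison L1 and the assembly L3 of the isolated twisted case — are NOT in the
tree). No stub closed by name. No definitions, no named facts, no sorry.
[cite: KempfEtAl1973, Ch. I §2 Thm. 11, Ch. II §2] [cite: Fulton1993Toric, §2.6 p. 48] [cite: Ewald1996, VI Thm. 8.5]
-/

-- single-problem summit: the doubled namespace component is forced
set_option linter.dupNamespace false

namespace Summit.ResolutionOfSingularities.ResolutionOfSingularities.Theorems.FRationalResolution.EquivariantLadder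

open Literature.Geometry.PolyhedralFans PointedCone Finset
open Summit.ResolutionOfSingularities.ResolutionOfSingularities.Theorems.FRationalResolution.OrbitSeparation
open Summit.ResolutionOfSingularities.ResolutionOfSingularities.Theorems.FRationalResolution.EquivariantStep

variable {κ : Type*}

/-! ## The corner ray -/

/-- **The corner ray is interior**: a positive multiple of `Σ_{s ∈ S₀} s` lies in no face of `hull S₀` other than
`hull S₀` itself (`S₀` linearly independent). [cite: Fulton1993Toric, §1.2 p. 9] -/
theorem corner_notMem_of_isFaceOf_of_ne {S₀ : Finset (κ → ℚ)} (hli : LinearIndepOn ℚ id (S₀ : Set (κ → ℚ)))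
    {τ : PointedCone ℚ (κ → ℚ)} (hτ : τ.IsFaceOf (PointedCone.hull ℚ (S₀ : Set (κ → ℚ))))
    (hne : τ ≠ PointedCone.hull ℚ (S₀ : Set (κ → ℚ))) {q : ℚ} (hq : 0 < q) :
    q • ∑ s ∈ S₀, s ∉ τ := by
  classical
  intro hmem
  have hτeq := eq_hull_filter_of_isFaceOf_hull hτ
  rw [hτeq] at hmem
  obtain ⟨b, hb, hbsum⟩ := mem_hull_finset_iff.mp hmem
  -- compare coefficients over `S₀`
  have hsum : ∑ s ∈ S₀, (fun s => if s ∈ τ then b s else 0) s • s = ∑ s ∈ S₀, (fun _ => q) s • s := by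
    simp only [ite_smul, zero_smul]
    rw [← Finset.sum_filter, hbsum, Finset.smul_sum]
  have hcoef := eq_on_of_sum_smul_eq hli hsum
  -- some generator is missing from `τ`
  obtain ⟨s₀, hs₀, hs₀τ⟩ : ∃ s ∈ S₀, s ∉ τ := by
    by_contra h
    push Not at h
    apply hne
    refine le_antisymm hτ.le ?_
    rw [PointedCone.hull, Submodule.span_le]
    exact fun s hs => h s hs
  have := hcoef s₀ hs₀
  simp only [if_neg hs₀τ] at this
  exact hq.ne this

/-- **The corner ray is not a generator** when there are at least two generators. [cite: Fulton1993Toric, §1.2 p. 9] -/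
theorem smul_sum_notMem {S₀ : Finset (κ → ℚ)} (hli : LinearIndepOn ℚ id (S₀ : Set (κ → ℚ))) (h2 : 2 ≤ S₀.card)
    (q : ℚ) : q • ∑ s ∈ S₀, s ∉ S₀ := by
  classical
  intro hmem
  have hsum : ∑ s ∈ S₀, (fun _ => q) s • s = ∑ s ∈ S₀, (fun s => if s = q • ∑ t ∈ S₀, t then (1 : ℚ) else 0) s • s := by
    simp only [ite_smul, one_smul, zero_smul]
    rw [Finset.sum_ite_eq' S₀ (q • ∑ t ∈ S₀, t) (fun s => s), if_pos hmem, ← Finset.smul_sum]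
  have hcoef := eq_on_of_sum_smul_eq hli hsum
  -- a second generator gets coefficient `q = 0`, the corner itself gets `q = 1`
  obtain ⟨s₁, hs₁, hne⟩ : ∃ s ∈ S₀, s ≠ q • ∑ t ∈ S₀, t := by
    by_contra h
    push Not at h
    have hcard : S₀.card ≤ 1 := Finset.card_le_one.mpr fun a ha b hb => by rw [h a ha, h b hb]
    omega
  have h0 : q = 0 := by simpa [if_neg hne] using hcoef s₁ hs₁
  have h1 : q = 1 := by simpa using hcoef _ hmem
  rw [h0] at h1
  exact zero_ne_one h1

/-- The corner `Σ_{s ∈ S₀} s` of a nonempty linearly independent family is non-zero. [cite: Fulton1993Toric, §1.2 p. 9] -/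
theorem sum_ne_zero {S₀ : Finset (κ → ℚ)} (hli : LinearIndepOn ℚ id (S₀ : Set (κ → ℚ))) (hne : S₀.Nonempty) :
    ∑ s ∈ S₀, s ≠ 0 := by
  intro h0
  obtain ⟨s₀, hs₀⟩ := hne
  have hsum : ∑ s ∈ S₀, (fun _ => (1 : ℚ)) s • s = ∑ s ∈ S₀, (fun _ => (0 : ℚ)) s • s := by
    simp only [one_smul, zero_smul, Finset.sum_const_zero]; exact h0
  have := eq_on_of_sum_smul_eq hli hsum s₀ hs₀
  exact one_ne_zero this

/-- A map sending the finite family `S₀` into itself injectively permutes it. [folklore] -/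
theorem image_eq_of_mapsTo [DecidableEq (κ → ℚ)] (g : (κ → ℚ) ≃ₗ[ℚ] (κ → ℚ)) {S₀ : Finset (κ → ℚ)}
    (hgS₀ : ∀ s ∈ S₀, g s ∈ S₀) : S₀.image g = S₀ := by
  apply Finset.eq_of_subset_of_card_le
  · intro u hu
    obtain ⟨s, hs, rfl⟩ := Finset.mem_image.mp hu
    exact hgS₀ s hs
  · rw [Finset.card_image_of_injective S₀ g.injective]

/-- A lattice automorphism permuting the generators fixes the corner ray. [folklore] -/
theorem map_smul_sum_eq [DecidableEq (κ → ℚ)] (g : (κ → ℚ) ≃ₗ[ℚ] (κ → ℚ)) {S₀ : Finset (κ → ℚ)}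
    (hgS₀ : ∀ s ∈ S₀, g s ∈ S₀) (q : ℚ) : g (q • ∑ s ∈ S₀, s) = q • ∑ s ∈ S₀, s := by
  rw [map_smul, map_sum]
  congr 1
  calc ∑ s ∈ S₀, g s = ∑ u ∈ S₀.image g, u :=
        (Finset.sum_image (f := fun u : κ → ℚ => u) fun x _ y _ h => g.injective h).symm
    _ = ∑ s ∈ S₀, s := by rw [image_eq_of_mapsTo g hgS₀]

/-- A lattice automorphism permuting the generators maps the cone onto itself. [folklore] -/
theorem map_hull_eq [DecidableEq (κ → ℚ)] (g : (κ → ℚ) ≃ₗ[ℚ] (κ → ℚ)) {S₀ : Finset (κ → ℚ)}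
    (hgS₀ : ∀ s ∈ S₀, g s ∈ S₀) :
    (PointedCone.hull ℚ (S₀ : Set (κ → ℚ))).map (g : (κ → ℚ) →ₗ[ℚ] (κ → ℚ)) =
      PointedCone.hull ℚ (S₀ : Set (κ → ℚ)) := by
  rw [map_hull_finset]
  have himg : S₀.image (g : (κ → ℚ) →ₗ[ℚ] (κ → ℚ)) = S₀.image g := Finset.image_congr fun x _ => by simp
  rw [himg, image_eq_of_mapsTo g hgS₀]

/-- **Generators of a face are generators of the cone**: if `τ` is a face of `hull S₀` with primitive simplicial
generators `K`, then `K ⊆ S₀`. [cite: Fulton1993Toric, §1.2 (2) p. 10] -/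
theorem gens_subset_of_isFaceOf {S₀ : Finset (κ → ℚ)} (hprim : ∀ s ∈ S₀, IsPrimitive s)
    (hli : LinearIndepOn ℚ id (S₀ : Set (κ → ℚ))) {τ : PointedCone ℚ (κ → ℚ)} {K : Finset (κ → ℚ)}
    (hK : IsPrimGens τ K) (hτ : τ.IsFaceOf (PointedCone.hull ℚ (S₀ : Set (κ → ℚ)))) : K ⊆ S₀ := by
  classical
  have hface : (PointedCone.hull ℚ (K : Set (κ → ℚ))).IsFaceOf (PointedCone.hull ℚ (S₀ : Set (κ → ℚ))) :=
    hK.2.2 ▸ hτ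
  have heq := eq_filter_of_isFaceOf hprim hli hK.1 hK.2.1 hface
  intro t ht
  rw [heq] at ht
  exact (Finset.mem_filter.mp ht).1

/-- **A proper face of the isolated cone has REGULAR primitive generators** `S₀ ∩ τ` (a proper subfamily of `S₀`).
[cite: Fulton1993Toric, §1.2 (2) p. 10] -/
theorem exists_isPrimGens_isRegularGens_of_isFaceOf {S₀ : Finset (κ → ℚ)} (hprim : ∀ s ∈ S₀, IsPrimitive s)
    (hli : LinearIndepOn ℚ id (S₀ : Set (κ → ℚ))) (hiso : ∀ J : Finset (κ → ℚ), J ⊂ S₀ → IsRegularGens J)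
    {τ : PointedCone ℚ (κ → ℚ)} (hτ : τ.IsFaceOf (PointedCone.hull ℚ (S₀ : Set (κ → ℚ))))
    (hne : τ ≠ PointedCone.hull ℚ (S₀ : Set (κ → ℚ))) :
    ∃ J : Finset (κ → ℚ), IsPrimGens τ J ∧ IsRegularGens J := by
  classical
  have hτeq := eq_hull_filter_of_isFaceOf_hull hτ
  refine ⟨S₀.filter (· ∈ τ), ⟨fun s hs => hprim s (Finset.mem_filter.mp hs).1, ?_, hτeq⟩, hiso _ ?_⟩
  · rw [Finset.coe_filter]; exact hli.mono fun s hs => hs.1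
  · refine Finset.ssubset_iff_subset_ne.mpr ⟨Finset.filter_subset _ _, fun h => hne ?_⟩
    rw [hτeq, h]

section Ladder

variable [Fintype κ] [DecidableEq κ]

omit [DecidableEq κ] in
/-- **Round 0 of the ladder.** Let `Δ₀` be the face fan of the isolated cone `hull S₀` (`|S₀| ≥ 2`), primitively simplicial,
`G` a set of lattice automorphisms closed under inverses permuting `S₀`, and `c = q • Σ_{s ∈ S₀} s` (`q > 0`) primitive with
`P c`. After the star subdivision through `c` the fan is primitively simplicial, `G`-stable, carries the interior-ray
invariant, no longer has `hull S₀` as a cone, keeps every cone inside `hull S₀` and every proper face of `hull S₀` as a cone,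
and every generator of every cone lies in `S₀` or satisfies `P`. [cite: KempfEtAl1973, Ch. II §2] -/
theorem round_zero {S₀ : Finset (κ → ℚ)} (hprim : ∀ s ∈ S₀, IsPrimitive s) (hli : LinearIndepOn ℚ id (S₀ : Set (κ → ℚ)))
    (h2 : 2 ≤ S₀.card) {Δ₀ : Fan ℚ (κ → ℚ)}
    (hΔ₀ : ∀ τ, τ ∈ Δ₀.cones ↔ τ.IsFaceOf (PointedCone.hull ℚ (S₀ : Set (κ → ℚ)))) (hps : Δ₀.IsPrimSimplicial)
    {G : Set ((κ → ℚ) ≃ₗ[ℚ] (κ → ℚ))} (hGsymm : ∀ g ∈ G, g.symm ∈ G) (hGS₀ : ∀ g ∈ G, ∀ s ∈ S₀, g s ∈ S₀)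
    {c : κ → ℚ} (hc : IsPrimitive c) {q : ℚ} (hq : 0 < q) (hcq : c = q • ∑ s ∈ S₀, s)
    (P : (κ → ℚ) → Prop) (hPc : P c) :
    (Δ₀.starIter [c]).IsPrimSimplicial ∧
    (∀ g ∈ G, ∀ ρ ∈ (Δ₀.starIter [c]).cones, ρ.map (g : (κ → ℚ) →ₗ[ℚ] (κ → ℚ)) ∈ (Δ₀.starIter [c]).cones) ∧
    (∀ g ∈ G, ∀ κ' ∈ (Δ₀.starIter [c]).cones, ∀ K : Finset (κ → ℚ), IsPrimGens κ' K →
      ∀ t ∈ K, t ∉ S₀ → g t ∈ K → g t = t) ∧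
    PointedCone.hull ℚ (S₀ : Set (κ → ℚ)) ∉ (Δ₀.starIter [c]).cones ∧
    (∀ ρ ∈ (Δ₀.starIter [c]).cones, ρ ≤ PointedCone.hull ℚ (S₀ : Set (κ → ℚ))) ∧
    (∀ τ ∈ Δ₀.cones, τ ≠ PointedCone.hull ℚ (S₀ : Set (κ → ℚ)) → τ ∈ (Δ₀.starIter [c]).cones) ∧
    (∀ ρ ∈ (Δ₀.starIter [c]).cones, ∀ K : Finset (κ → ℚ), IsPrimGens ρ K → ∀ r ∈ K, r ∈ S₀ ∨ P r) := by
  classical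
  have hS₀gens : IsPrimGens (PointedCone.hull ℚ (S₀ : Set (κ → ℚ))) S₀ := ⟨hprim, hli, rfl⟩
  -- the face fan: `G`-stable, interior-ray invariant vacuous, cones inside `hull S₀`
  have hGΔ₀ : ∀ g ∈ G, ∀ τ ∈ Δ₀.cones, τ.map (g : (κ → ℚ) →ₗ[ℚ] (κ → ℚ)) ∈ Δ₀.cones := by
    intro g hg τ hτ
    have hinj : ∀ x ∈ (⊤ : Submodule ℚ (κ → ℚ)), (g : (κ → ℚ) →ₗ[ℚ] (κ → ℚ)) x = 0 → x = 0 :=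
      fun x _ hx => by simpa using hx
    have hface := isFaceOf_map_of_isFaceOf hinj ((hΔ₀ τ).1 hτ) (fun _ _ => Submodule.mem_top)
    rw [map_hull_eq g (hGS₀ g hg)] at hface
    exact (hΔ₀ _).2 hface
  have hfix₀ : ∀ g ∈ G, ∀ τ ∈ Δ₀.cones, ∀ K : Finset (κ → ℚ), IsPrimGens τ K →
      ∀ t ∈ K, t ∉ S₀ → g t ∈ K → g t = t := by
    intro g _ τ hτ K hK t ht htS _
    exact absurd (gens_subset_of_isFaceOf hprim hli hK ((hΔ₀ τ).1 hτ) ht) htS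
  have hle₀ : ∀ τ ∈ Δ₀.cones, τ ≤ PointedCone.hull ℚ (S₀ : Set (κ → ℚ)) := fun τ hτ => ((hΔ₀ τ).1 hτ).le
  -- the one-point list `[c]`
  have hnd : [c].Nodup := List.nodup_singleton c
  have hlG : ∀ g ∈ G, ∀ z ∈ [c], g z ∈ [c] := by
    intro g hg z hz
    rw [List.mem_singleton] at hz ⊢
    rw [hz, hcq, map_smul_sum_eq g (hGS₀ g hg)]
  have hsep₀ : ∀ σ' ∈ Δ₀.cones, ∀ z ∈ [c], ∀ z' ∈ [c], z ∈ σ' → z' ∈ σ' → z = z' := by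
    intro σ' _ z hz z' hz' _ _
    rw [List.mem_singleton] at hz hz'
    rw [hz, hz']
  have hprimc : ∀ z ∈ [c], IsPrimitive z := fun z hz => by rw [List.mem_singleton] at hz; rw [hz]; exact hc
  have hcσ : c ∈ PointedCone.hull ℚ (S₀ : Set (κ → ℚ)) := by
    rw [hcq]
    exact smul_mem_of_nonneg (Submodule.sum_mem _ fun s hs => PointedCone.subset_hull (Finset.mem_coe.mpr hs)) hq.le
  refine ⟨?_, ?_, ?_, ?_, ?_, ?_, ?_⟩
  · exact Fan.isPrimSimplicial_starSubdivision_of_isPrimitive hps hc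
  · intro g hg ρ hρ
    exact map_mem_starIter_of_closed hGsymm hGΔ₀ hnd hlG hsep₀ hg hρ
  · intro g hg κ' hκ' K hK t ht htS hgt
    exact fix_starIter_of_closed hps hGsymm hfix₀ hnd hlG hprimc hsep₀ hg hκ' hK ht htS hgt
  · intro h
    rw [Fan.mem_starIter_cones_iff_of_separated [c] hnd hsep₀] at h
    rcases h with ⟨-, havoid⟩ | ⟨z, hz, τ, hτ, hzτ, ⟨σ', hσ', hτσ', hzσ'⟩, heq⟩
    · exact havoid c (List.mem_singleton_self c) hcσ
    · rw [List.mem_singleton] at hz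
      rw [hz] at hzτ hzσ' heq
      obtain ⟨Tτ, hTτ⟩ := hps.exists_isPrimGens hτ
      have hnew := isPrimGens_sup_ray hτ hσ' hτσ' hTτ hc hzσ' hzτ
      rw [← heq] at hnew
      have hS₀eq : S₀ = insert c Tτ := hS₀gens.unique hnew
      have hcS₀ : c ∈ S₀ := hS₀eq ▸ Finset.mem_insert_self c Tτ
      exact smul_sum_notMem hli h2 q (hcq ▸ hcS₀)
  · intro ρ hρ
    exact le_hull_of_mem_starIter hle₀ [c] hρ
  · intro τ hτ hne
    rw [Fan.mem_starIter_cones_iff_of_separated [c] hnd hsep₀]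
    refine Or.inl ⟨hτ, fun z hz => ?_⟩
    rw [List.mem_singleton] at hz
    rw [hz, hcq]
    exact corner_notMem_of_isFaceOf_of_ne hli ((hΔ₀ τ).1 hτ) hne hq
  · intro ρ hρ K hK r hr
    rw [Fan.mem_starIter_cones_iff_of_separated [c] hnd hsep₀] at hρ
    rcases hρ with ⟨hρΔ, -⟩ | ⟨z, hz, τ, hτ, hzτ, ⟨σ', hσ', hτσ', hzσ'⟩, rfl⟩
    · exact Or.inl (gens_subset_of_isFaceOf hprim hli hK ((hΔ₀ ρ).1 hρΔ) hr)
    · rw [List.mem_singleton] at hz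
      rw [hz] at hzτ hzσ' hK
      obtain ⟨Tτ, hTτ⟩ := hps.exists_isPrimGens hτ
      have hnew := isPrimGens_sup_ray hτ hσ' hτσ' hTτ hc hzσ' hzτ
      rw [hK.unique hnew] at hr
      rcases Finset.mem_insert.mp hr with rfl | hrT
      · exact Or.inr hPc
      · exact Or.inl (gens_subset_of_isFaceOf hprim hli hTτ ((hΔ₀ τ).1 hτ) hrT)

/-- **THE EQUIVARIANT BOUNDARY-SPARING LADDER THEOREM (lane W‴, statement L2′).** Let `S₀ ⊆ ℚ^κ` be `≥ 2` linearly
independent primitive lattice vectors all of whose proper subfamilies are regular (the isolated simplicial cone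
`σ = hull S₀`), `G` a finite set of lattice automorphisms containing `1`, closed under inverses and composition, each
permuting `S₀`, and `P` a property of vectors holding for the primitive corner vector and closed under parallelotope lattice
points of cones generated in `S₀ ∪ P`. Then there is a list `l` of non-zero lattice vectors such that the iterated star
subdivision `Δ' = (face fan of σ).starIter l` refines the face fan, is REGULAR and primitively simplicial, is `G`-STABLE
(`g` carries cones to cones), keeps every PROPER FACE of `σ` as a cone, carries the interior-ray invariant, and every
primitive generator of every cone of `Δ'` lies in `S₀` or satisfies `P`. Proof: round 0 through the corner (`round_zero`),
then the synchronised loop `Fan.exists_regular_starIter_of_invariant` over `G`-orbits of parallelotope points of cones of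
maximal count, separated by the orbit separation lemma. [cite: KempfEtAl1973, Ch. I §2 Thm. 11, Ch. II §2]
[cite: Fulton1993Toric, §2.6 p. 48] [cite: Ewald1996, VI Thm. 8.5] -/
theorem exists_equivariant_regular_starIter {S₀ : Finset (κ → ℚ)} (hprim : ∀ s ∈ S₀, IsPrimitive s)
    (hli : LinearIndepOn ℚ id (S₀ : Set (κ → ℚ))) (h2 : 2 ≤ S₀.card)
    (hiso : ∀ J : Finset (κ → ℚ), J ⊂ S₀ → IsRegularGens J)
    (hfg : (PointedCone.hull ℚ (S₀ : Set (κ → ℚ))).FG) (hsal : IsSalient (PointedCone.hull ℚ (S₀ : Set (κ → ℚ))))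
    {G : Set ((κ → ℚ) ≃ₗ[ℚ] (κ → ℚ))} (hGfin : G.Finite) (hG1 : LinearEquiv.refl ℚ (κ → ℚ) ∈ G)
    (hGN : ∀ g ∈ G, ∀ x ∈ latticeN κ, g x ∈ latticeN κ)
    (hGsymm : ∀ g ∈ G, g.symm ∈ G) (hGtrans : ∀ g ∈ G, ∀ h ∈ G, g.trans h ∈ G)
    (hGS₀ : ∀ g ∈ G, ∀ s ∈ S₀, g s ∈ S₀)
    (P : (κ → ℚ) → Prop)
    (hP₁ : ∀ q : ℚ, 0 < q → IsPrimitive (q • ∑ s ∈ S₀, s) → P (q • ∑ s ∈ S₀, s))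
    (hP₂ : ∀ (T : Finset (κ → ℚ)) (a : (κ → ℚ) → ℚ), (∀ t ∈ T, t ∈ S₀ ∨ P t) → a ∈ parCoeffs T →
      P (∑ t ∈ T, a t • t)) :
    ∃ l : List (κ → ℚ), (∀ w ∈ l, w ∈ latticeN κ ∧ w ≠ 0) ∧
      ((Fan.ofCone _ hfg hsal).starIter l).Refines (Fan.ofCone _ hfg hsal) ∧
      ((Fan.ofCone _ hfg hsal).starIter l).IsRegular ∧
      ((Fan.ofCone _ hfg hsal).starIter l).IsPrimSimplicial ∧
      (∀ g ∈ G, ∀ ρ ∈ ((Fan.ofCone _ hfg hsal).starIter l).cones,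
        ρ.map (g : (κ → ℚ) →ₗ[ℚ] (κ → ℚ)) ∈ ((Fan.ofCone _ hfg hsal).starIter l).cones) ∧
      (∀ τ : PointedCone ℚ (κ → ℚ), τ.IsFaceOf (PointedCone.hull ℚ (S₀ : Set (κ → ℚ))) →
        τ ≠ PointedCone.hull ℚ (S₀ : Set (κ → ℚ)) → τ ∈ ((Fan.ofCone _ hfg hsal).starIter l).cones) ∧
      (∀ g ∈ G, ∀ κ' ∈ ((Fan.ofCone _ hfg hsal).starIter l).cones, ∀ K : Finset (κ → ℚ), IsPrimGens κ' K →
        ∀ t ∈ K, t ∉ S₀ → g t ∈ K → g t = t) ∧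
      (∀ ρ ∈ ((Fan.ofCone _ hfg hsal).starIter l).cones, ∀ K : Finset (κ → ℚ), IsPrimGens ρ K →
        ∀ r ∈ K, r ∈ S₀ ∨ P r) := by
  classical
  set Δ₀ := Fan.ofCone (PointedCone.hull ℚ (S₀ : Set (κ → ℚ))) hfg hsal with hΔ₀def
  have hΔ₀ : ∀ τ, τ ∈ Δ₀.cones ↔ τ.IsFaceOf (PointedCone.hull ℚ (S₀ : Set (κ → ℚ))) := fun τ => Fan.mem_ofCone_iff
  have hps₀ : Δ₀.IsPrimSimplicial := Fan.isPrimSimplicial_ofCone_hull (fun s hs => (hprim s hs).1) hli hfg hsal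
  -- the primitive corner vector
  have hne : S₀.Nonempty := Finset.card_pos.mp (by omega)
  have hc₀N : ∑ s ∈ S₀, s ∈ latticeN κ := Submodule.sum_mem _ fun s hs => (hprim s hs).1
  obtain ⟨q, hq, -, hc⟩ := exists_isPrimitive_smul hc₀N (sum_ne_zero hli hne)
  set c := q • ∑ s ∈ S₀, s with hcq
  have hPc : P c := hP₁ q hq hc
  -- round 0
  obtain ⟨hps₁, hG₁, hfix₁, hσ₁, hle₁, hfaces₁, hP₁'⟩ :=
    round_zero hprim hli h2 hΔ₀ hps₀ hGsymm hGS₀ hc hq hcq P hPc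
  set Δ₁ := Δ₀.starIter [c] with hΔ₁def
  -- the invariant of the loop
  let I : Fan ℚ (κ → ℚ) → Prop := fun Δ' =>
    (∀ g ∈ G, ∀ ρ ∈ Δ'.cones, ρ.map (g : (κ → ℚ) →ₗ[ℚ] (κ → ℚ)) ∈ Δ'.cones) ∧
    (∀ g ∈ G, ∀ κ' ∈ Δ'.cones, ∀ K : Finset (κ → ℚ), IsPrimGens κ' K → ∀ t ∈ K, t ∉ S₀ → g t ∈ K → g t = t) ∧
    PointedCone.hull ℚ (S₀ : Set (κ → ℚ)) ∉ Δ'.cones ∧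
    (∀ ρ ∈ Δ'.cones, ρ ≤ PointedCone.hull ℚ (S₀ : Set (κ → ℚ))) ∧
    (∀ τ ∈ Δ₀.cones, τ ≠ PointedCone.hull ℚ (S₀ : Set (κ → ℚ)) → τ ∈ Δ'.cones) ∧
    (∀ ρ ∈ Δ'.cones, ∀ K : Finset (κ → ℚ), IsPrimGens ρ K → ∀ r ∈ K, r ∈ S₀ ∨ P r)
  have hI₁ : I Δ₁ := ⟨hG₁, hfix₁, hσ₁, hle₁, hfaces₁, hP₁'⟩
  -- the synchronised step at the orbit of a parallelotope point of a cone of maximal count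
  have step : ∀ Γ : Fan ℚ (κ → ℚ), I Γ → Γ.IsPrimSimplicial → ¬ Γ.IsRegular →
      ∃ l : List (κ → ℚ), l ≠ [] ∧ l.Nodup ∧
        (∀ z ∈ l, IsPrimitive z ∧ ∃ σ ∈ Γ.cones, ∃ S : Finset (κ → ℚ), IsPrimGens σ S ∧
          conePMult σ = Γ.maxPMult ∧ ∃ a ∈ parCoeffs S, z = ∑ s ∈ S, a s • s) ∧
        (∀ σ ∈ Γ.cones, ∀ z ∈ l, ∀ z' ∈ l, z ∈ σ → z' ∈ σ → z = z') ∧ I (Γ.starIter l) := by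
    rintro Γ ⟨hGΓ, hfixΓ, hσΓ, hleΓ, hfacesΓ, hPΓ⟩ hpsΓ hnr
    obtain ⟨σ₁, hσ₁Γ, S, hS, hcount, a, ha, hwprim, -, j, hj, haj⟩ := Fan.exists_parPoint_of_not_isRegular hpsΓ hnr
    set w := ∑ s ∈ S, a s • s with hwdef
    have hw0 : w ≠ 0 := hwprim.2.1
    set Z : Finset (κ → ℚ) := hGfin.toFinset.image (fun g : (κ → ℚ) ≃ₗ[ℚ] (κ → ℚ) => g w) with hZdef
    set l := Z.toList with hldef
    have hlZ : ∀ z, z ∈ l ↔ z ∈ Z := fun z => Finset.mem_toList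
    have hl : ∀ z ∈ l, ∃ g ∈ G, z = g w := by
      intro z hz
      obtain ⟨g, hg, rfl⟩ := Finset.mem_image.mp ((hlZ z).1 hz)
      exact ⟨g, hGfin.mem_toFinset.mp hg, rfl⟩
    have hmemZ : ∀ g ∈ G, g w ∈ l := fun g hg =>
      (hlZ _).2 (Finset.mem_image.mpr ⟨g, hGfin.mem_toFinset.mpr hg, rfl⟩)
    have hlG : ∀ g ∈ G, ∀ z ∈ l, g z ∈ l := by
      intro g hg z hz
      obtain ⟨h, hh, rfl⟩ := hl z hz
      have := hmemZ _ (hGtrans h hh g hg)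
      simpa using this
    have hnd : l.Nodup := Finset.nodup_toList Z
    have hlne : l ≠ [] := by
      intro h
      have := hmemZ _ hG1
      rw [h] at this
      exact List.not_mem_nil this
    have hsep := orbitList_separated hpsΓ hleΓ hσΓ hiso hGN hGsymm hGtrans hGS₀ hGΓ hfixΓ hσ₁Γ hS ha hl
    have hprimZ : ∀ z ∈ l, IsPrimitive z := by
      intro z hz
      obtain ⟨g, hg, rfl⟩ := hl z hz
      exact (orbit_point g (hGN g hg) (hGN _ (hGsymm g hg)) hS ha).2.2.2.2 hwprim
    refine ⟨l, hlne, hnd, ?_, hsep, ?_, ?_, ?_, ?_, ?_, ?_⟩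
    · intro z hz
      obtain ⟨g, hg, rfl⟩ := hl z hz
      obtain ⟨hT₁, ha₁, hsum₁, hcount₁, hprim₁⟩ := orbit_point g (hGN g hg) (hGN _ (hGsymm g hg)) hS ha
      exact ⟨hprim₁ hwprim, _, hGΓ g hg σ₁ hσ₁Γ, S.image g, hT₁, hcount₁.trans hcount, _, ha₁, hsum₁.symm⟩
    · intro g hg ρ hρ
      exact map_mem_starIter_of_closed hGsymm hGΓ hnd hlG hsep hg hρ
    · intro g hg κ' hκ' K hK t ht htS hgt
      exact fix_starIter_of_closed hpsΓ hGsymm hfixΓ hnd hlG hprimZ hsep hg hκ' hK ht htS hgt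
    · exact hull_notMem_starIter hleΓ hσΓ l
    · intro ρ hρ
      exact le_hull_of_mem_starIter hleΓ l hρ
    · intro τ hτ hne'
      obtain ⟨J, hJ, hJreg⟩ := exists_isPrimGens_isRegularGens_of_isFaceOf hprim hli hiso ((hΔ₀ τ).1 hτ) hne'
      exact (mem_starIter_orbit_of_isRegularGens hGN hGsymm hGΓ hσ₁Γ hS ha hw0 hnd hl hsep (hfacesΓ τ hτ hne')
        hJ hJreg).1
    · intro ρ hρ K hK r hr
      rw [Fan.mem_starIter_cones_iff_of_separated l hnd hsep] at hρ
      rcases hρ with ⟨hρΓ, -⟩ | ⟨z, hz, τ, hτ, hzτ, ⟨σ', hσ', hτσ', hzσ'⟩, rfl⟩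
      · exact hPΓ ρ hρΓ K hK r hr
      · obtain ⟨Tτ, hTτ⟩ := hpsΓ.exists_isPrimGens hτ
        have hnew := isPrimGens_sup_ray hτ hσ' hτσ' hTτ (hprimZ z hz) hzσ' hzτ
        rw [hK.unique hnew] at hr
        rcases Finset.mem_insert.mp hr with rfl | hrT
        · obtain ⟨g, hg, rfl⟩ := hl _ hz
          obtain ⟨hT₁, ha₁, hsum₁, -, -⟩ := orbit_point g (hGN g hg) (hGN _ (hGsymm g hg)) hS ha
          rw [← hsum₁]
          refine Or.inr (hP₂ _ _ (fun u hu => hPΓ _ (hGΓ g hg σ₁ hσ₁Γ) _ hT₁ u hu) ha₁)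
        · exact hPΓ τ hτ Tτ hTτ r hrT
  -- run the loop from `Δ₁`
  obtain ⟨L, hL, href, hreg, hps', hI'⟩ := Fan.exists_regular_starIter_of_invariant step hI₁ hps₁
  obtain ⟨hG', hfix', -, -, hfaces', hP'⟩ := hI'
  have hcsupp : c ∈ Δ₀.support := by
    rw [hΔ₀def, Fan.support_ofCone]
    exact smul_mem_of_nonneg (Submodule.sum_mem _ fun s hs => PointedCone.subset_hull (Finset.mem_coe.mpr hs)) hq.le
  have href₁ : Δ₁.Refines Δ₀ := (Fan.starSubdivision_refines hcsupp hc.2.1).1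
  refine ⟨c :: L, ?_, ?_, ?_, ?_, ?_, ?_, ?_, ?_⟩
  · intro w hw
    rcases List.mem_cons.mp hw with rfl | hw
    · exact ⟨hc.1, hc.2.1⟩
    · exact hL w hw
  · rw [Fan.starIter_cons]; exact href.trans href₁
  · rw [Fan.starIter_cons]; exact hreg
  · rw [Fan.starIter_cons]; exact hps'
  · rw [Fan.starIter_cons]; exact hG'
  · intro τ hτ hne'
    rw [Fan.starIter_cons]
    exact hfaces' τ ((hΔ₀ τ).2 hτ) hne'
  · rw [Fan.starIter_cons]; exact hfix'
  · rw [Fan.starIter_cons]; exact hP'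

end Ladder

end Summit.ResolutionOfSingularities.ResolutionOfSingularities.Theorems.FRationalResolution.EquivariantLadder
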